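import Mathlib
import HarnessLib
import Summits.ValiantsHypothesis.ValiantsHypothesis.Theses.MonotoneRestoration
import Literature.Computability.AlgebraicComplexity.ArithCircuit
import Literature.Computability.AlgebraicComplexity.ArithCircuitProofs
import Literature.Computability.AlgebraicComplexity.MonotoneStructure
import Literature.Computability.AlgebraicComplexity.PermanentIrreducible
import Literature.ModelTheory.FiniteModelTheory.CkEquiv
import Summits.ValiantsHypothesis.ValiantsHypothesis.Theorems.MonotoneRestorationMonotoneRestorationQPCosetCount
import Summits.ValiantsHypothesis.ValiantsHypothesis.Theorems.MonotoneRestorationMonotoneRestorationQPSymmetricLB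
import Summits.ValiantsHypothesis.ValiantsHypothesis.Theorems.MonotoneRestorationMonotoneRestorationQPSupportSymmetrisation
import Summits.ValiantsHypothesis.ValiantsHypothesis.Theorems.MonotoneRestorationMonotoneRestorationQPSparseRegime
import Summits.ValiantsHypothesis.ValiantsHypothesis.Theorems.MonotoneRestorationMonotoneRestorationQPBeta
import Literature.Computability.AlgebraicComplexity.SymmetricArithCircuit
import Literature.Computability.AlgebraicComplexity.DawarWilsenach2025Proofs
import Literature.GroupTheory.PermutationGroups.SmallIndexSubgroups
import Summits.ValiantsHypothesis.ValiantsHypothesis.Theorems.MonotoneRestorationQP.Negative.LoadBearing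
import Summits.ValiantsHypothesis.ValiantsHypothesis.Theorems.MonotoneRestorationMonotoneRestorationQPPermSupportCount
import Summits.ValiantsHypothesis.ValiantsHypothesis.Theorems.MonotoneRestorationMonotoneRestorationQPVariants19129

/-! TTRL-lite variant V20184 of stmt-ValiantsHypothesis-15886 -/

-- `Summit.ValiantsHypothesis.ValiantsHypothesis.…` is the tree's mandated single-conjunct layout
-- (Sub = Summit), so the duplicated namespace component is intended.
set_option linter.dupNamespace false

namespace Summit.ValiantsHypothesis.ValiantsHypothesis.Theorems

open Summit.ValiantsHypothesis.ValiantsHypothesis.Theses.MonotoneRestoration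
open Literature.Computability.AlgebraicComplexity

/-- **TTRL-lite variant V20184 of `stub_esymmRowSums_structure` (stmt-ValiantsHypothesis-15886).**
Block supports are disjoint: for two different row sets `t ≠ t'`, the products of row sums
`∏_{i ∈ t} R_i` and `∏_{i ∈ t'} R_i`, `R_i = Σ_j x_{i,j}`, over `ℝ≥0` have disjoint supports.
Proof: by `stub_esymmRowSums_structure_var19129` every monomial of `∏_{i ∈ t} R_i` has row
degrees equal to the indicator of `t` (`IsOrdered t`); a common monomial would force the
indicators of `t` and `t'` to agree at every row, i.e. `t = t'`. [folklore] -/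
theorem stub_esymmRowSums_structure_var20184 :
    ∀ (n : ℕ) (t t' : Finset (Fin n)), t ≠ t' →
      Disjoint (∏ i ∈ t, ∑ j : Fin n, (MvPolynomial.X (i, j) : MvPolynomial (Fin n × Fin n) NNReal)).support
        (∏ i ∈ t', ∑ j : Fin n, (MvPolynomial.X (i, j) : MvPolynomial (Fin n × Fin n) NNReal)).support := by
  intro n t t' htt'
  rw [Finset.disjoint_left]
  intro m hm hm'
  apply htt'
  ext i
  have h1 := stub_esymmRowSums_structure_var19129 n t m hm i
  have h2 := stub_esymmRowSums_structure_var19129 n t' m hm' i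
  rw [h1] at h2
  split_ifs at h2 with hi hi' hi' <;> simp_all

end Summit.ValiantsHypothesis.ValiantsHypothesis.Theorems
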